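import Summits.QuantumFields.QCD.Theses.WilsonMobilityGap
import Summits.QuantumFields.QCD.Theorems.MobilityGap.Negative.LowerPin
import Literature.MathematicalPhysics.QuantumFieldTheory.QCDPhaseQuenchedPositivity
import Summits.QuantumFields.QCD.Theorems.ChiralDescent.Negative.FlavourGuard
import Summits.QuantumFields.QCD.Theorems.GluonicCompletion.Negative.Threshold
import Summits.QuantumFields.QCD.Theorems.RobustYangMillsHandover.Negative.ChiralityObstruction

/-!
# Crux `ChiralMobilityGap` (stmt-QuantumFields-17497), negative side — algebra of the chiral pin

Support file of the standing disprover (cdisprove seat, cycle 1) of crux `ChiralMobilityGap` of route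
`WilsonMobilityGap` (`Summit.QuantumFields.QCD.Theses.WilsonMobilityGap.ChiralMobilityGap` = the
support crux `MobilityGap` with the pin `reg.IsChiralAtZero ∧` inserted).  No refutation — the crux
survives cycle 1; this is the load-bearing analysis of the NEW hypothesis, the pin, sorry-free, on top of
`MobilityGap/Negative/LowerPin.lean` (whose clause abbreviations `ClauseI`/`Upper`/`Lower`/`Sign`/`Clauses`
are reused):

* `chiralMobilityGap_iff` (`Iff.rfl` re-read), `not_chiralMobilityGap_of_not_mobilityGap` (a refutation of
  the support crux refutes the pinned one), `chiralMobilityGap_witness_window` (LowerPin's (iii)-window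
  transfers to every pinned witness).
* `isChiralAtZero_iff_small`: only small rates `ε` matter in the pin (monotonicity of the gap in the
  rate is the landed `ChiralDescent.Negative.hasLatticeMassGap_mono`).
* the upward offset `{ reg with mcrit := fun k => reg.mcrit k + reg.a k * M₀ / reg.Zm k }`
  (`m_crit(k) ↦ m_crit(k) + a_k M₀/Z_m(k)`, explicit structure literal as in the landed
  `GluonicCompletion.Negative.scheme_mcrit_shift` / `RobustYangMillsHandover.Negative.*_mcrit_shift_*`,
  which are reused): `bare_shift`, `clauseI_shift`/`upper_shift`/`lower_shift`/`sign_shift`,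
  `clauses_shift` — the UNPINNED package of THIS crux (both scalings + (i)–(iv) ∀ m > 0) is invariant
  under every upward shift, while the pin is not (landed
  `not_isChiralAtZero_mcrit_shift_of_uniformGapAbove`); hence `exists_clauses_not_chiral_of_gappedWitness` /
  `not_forall_clauses_imp_chiral_of_gappedWitness`: modulo ONE gapped package witness, the free-standing
  split "∀ reg, package → pin" is false — the pin is an obligation on the prover's own `∃`-witness only,
  and no argument from (i)–(iv) alone can ever refute it.
* `isChiralAtZero_of_equalTime_unbounded` (softness: an equal-time blow-up of the signed functional at ONE
  tuple makes `reg` chiral at zero for every `ε`), `isChiralAtZero_iff_frequently` (the pin is a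
  frequently-in-`k` condition).
* `det_diracMatrix_two_degenerate_eq_norm`, `signRatio_eq_one_two_degenerate`, `sign_two_degenerate`:
  clause (iv) holds with ratio `1` on the DIAGONAL of the `N_f = 2` mass plane at every bare mass — its
  `N_f = 2` content lies in split tuples; `N_f = 3` has no parity cancellation. [folklore]
-/

noncomputable section

namespace Summit.QuantumFields.QCD.Theorems.ChiralMobilityGap.Negative

open scoped BigOperators Topology
open MeasureTheory Filter Set
open Literature.MathematicalPhysics.QuantumFieldTheory Literature.MathematicalPhysics.QuantumLattice
  Literature.Probability.LatticeModels
open Summit.QuantumFields.QCD.Theorems.MobilityGapNegative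

variable {Nf : ℕ}

/-! ### §0 The pinned crux, re-read, and its transfer to `MobilityGap` -/

/-- The pinned crux, re-read clause by clause with LowerPin's abbreviations (definitional). [folklore] -/
theorem chiralMobilityGap_iff :
    Summit.QuantumFields.QCD.Theses.WilsonMobilityGap.ChiralMobilityGap ↔
      ∀ Nf : ℕ, Nf = 2 ∨ Nf = 3 → ∃ reg : QCDRegularisation Nf,
        reg.HasMassScaling ∧ reg.IsChiralAtZero ∧ (reg.scheme 0 0 0).HasAsymptoticScaling ∧
          ∀ m : Fin Nf → ℝ, (∀ f, 0 < m f) → ClauseI reg m ∧ Upper reg m ∧ Lower reg m ∧ Sign reg m :=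
  Iff.rfl

/-- The pinned crux is "the unpinned package `Clauses` AND the pin" (reordering of conjuncts). [folklore] -/
theorem chiralMobilityGap_iff_clauses_and_pin :
    Summit.QuantumFields.QCD.Theses.WilsonMobilityGap.ChiralMobilityGap ↔
      ∀ Nf : ℕ, Nf = 2 ∨ Nf = 3 → ∃ reg : QCDRegularisation Nf, Clauses Nf reg ∧ reg.IsChiralAtZero := by
  rw [chiralMobilityGap_iff]
  refine forall₂_congr fun Nf _ => exists_congr fun reg => ?_
  unfold Clauses
  tauto

/-- **The pinned crux implies the unpinned support crux** (drop the pin), stated as the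
contrapositive — the shape a refutation via the support crux would take: every negative result on
`MobilityGap` refutes `ChiralMobilityGap` a fortiori, and every lemma banked on a witness transfers.
(The positive implication `ChiralMobilityGap → MobilityGap` is the planner's one-liner
`mobilityGap_of_chiralMobilityGap`; it is not restated here so that no theorem of this file has a
Theses decl as its conclusion.) -/
theorem not_chiralMobilityGap_of_not_mobilityGap
    (h : ¬ Summit.QuantumFields.QCD.Theses.WilsonMobilityGap.MobilityGap) :
    ¬ Summit.QuantumFields.QCD.Theses.WilsonMobilityGap.ChiralMobilityGap := by
  intro hc
  refine h fun Nf hNf => ?_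
  obtain ⟨reg, h1, -, h3, h4⟩ := hc Nf hNf
  exact ⟨reg, h1, h3, h4⟩

/-- **Transfer of the (iii)-window.** Every witness of the pinned crux realises, for every positive
mass tuple, bare trajectories eventually inside `|m_f(k) + 4| < 41/10` with `m_crit(k) < 1/10`
eventually (LowerPin §2: clause (iii) alone excludes the convergent hopping region). -/
theorem chiralMobilityGap_witness_window
    (h : Summit.QuantumFields.QCD.Theses.WilsonMobilityGap.ChiralMobilityGap) :
    ∀ Nf : ℕ, Nf = 2 ∨ Nf = 3 → ∃ reg : QCDRegularisation Nf, (Clauses Nf reg ∧ reg.IsChiralAtZero) ∧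
      ∀ m : Fin Nf → ℝ, (∀ f, 0 < m f) → ∀ f : Fin Nf,
        (∀ᶠ k in atTop, |reg.mcrit k + reg.a k * m f / reg.Zm k + 4| < 41 / 10) ∧
        (∀ᶠ k in atTop, reg.mcrit k < 1 / 10) := by
  intro Nf hNf
  obtain ⟨reg, hreg⟩ := chiralMobilityGap_iff_clauses_and_pin.1 h Nf hNf
  exact ⟨reg, hreg, fun m hm f =>
    ⟨eventually_window_of_lower reg m (hreg.1.2.2 m hm).2.2.1 f,
     eventually_mcrit_lt_of_lower reg m hm (hreg.1.2.2 m hm).2.2.1 f⟩⟩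

/-! ### §1 Pin algebra: monotonicity, the offset shift, softness -/

/-- **Only small `ε` matter in the pin**: for any `ε₀ > 0`, `IsChiralAtZero` is equivalent to its
restriction to `ε < ε₀` (gaplessness at rate `ε` is inherited by every larger rate). -/
theorem isChiralAtZero_iff_small (reg : QCDRegularisation Nf) {ε₀ : ℝ} (hε₀ : 0 < ε₀) :
    reg.IsChiralAtZero ↔
      ∀ ε : ℝ, 0 < ε → ε < ε₀ → ∃ m : Fin Nf → ℝ, (∀ f, 0 < m f) ∧
        ¬ (reg.scheme m 0 0).HasLatticeMassGap ε := by
  constructor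
  · exact fun h ε hε _ => h ε hε
  · intro h ε hε
    obtain ⟨m, hm, hng⟩ := h (min ε (ε₀ / 2)) (lt_min hε (by linarith))
      (lt_of_le_of_lt (min_le_right _ _) (by linarith))
    exact ⟨m, hm, fun hg => hng (Summit.QuantumFields.QCD.Theorems.ChiralDescent.Negative.hasLatticeMassGap_mono _
          (min_le_left _ _) hg)⟩

/-! #### The offset shift `m_crit(k) ↦ m_crit(k) + a_k M₀/Z_m(k)`

All other data unchanged — the symmetry behind the threshold reading of the pre-re-type `QCDOf`
(landed: `GluonicCompletion.Negative.scheme_mcrit_shift` — the shifted scheme at `m` is the original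
at `M₀ + m`; `RobustYangMillsHandover.Negative.hasMassScaling_mcrit_shift_iff`,
`isChiralAtZero_mcrit_shift_iff`, `not_isChiralAtZero_mcrit_shift_of_uniformGapAbove` — the pin is NOT
shift-invariant: a uniform gap above `M₀` kills the chirality of the shifted regularisation).  New
here: the per-mass CLAUSES of this crux are shift-covariant, so the whole unpinned package is
invariant.  Written as the explicit structure literal
`({ reg with mcrit := fun k => reg.mcrit k + reg.a k * M₀ / reg.Zm k } : QCDRegularisation Nf)`
throughout (no abbreviation), as in the landed files. -/

/-- The realised bare tuples of the shifted regularisation. [folklore] -/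
theorem bare_shift (reg : QCDRegularisation Nf) (M₀ : ℝ) (m : Fin Nf → ℝ) (k : ℕ) :
    bare ({ reg with mcrit := fun k => reg.mcrit k + reg.a k * M₀ / reg.Zm k } :
        QCDRegularisation Nf) m k = bare reg (fun f => M₀ + m f) k := by
  funext f
  simp only [bare]
  ring

/-- The shift does not touch asymptotic scaling (which reads `β`, `a` only; for `HasMassScaling` this is
the landed `RobustYangMillsHandover.Negative.hasMassScaling_mcrit_shift_iff`). [folklore] -/
theorem hasAsymptoticScaling_shift (reg : QCDRegularisation Nf) (M₀ : ℝ) :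
    (({ reg with mcrit := fun k => reg.mcrit k + reg.a k * M₀ / reg.Zm k } :
        QCDRegularisation Nf).scheme 0 0 0).HasAsymptoticScaling ↔
      (reg.scheme 0 0 0).HasAsymptoticScaling :=
  Iff.rfl

/-- Clause (i) of the shifted regularisation at `m` is clause (i) of the original at `M₀ + m`.
[folklore] -/
theorem clauseI_shift (reg : QCDRegularisation Nf) (M₀ : ℝ) (m : Fin Nf → ℝ) :
    ClauseI ({ reg with mcrit := fun k => reg.mcrit k + reg.a k * M₀ / reg.Zm k } :
        QCDRegularisation Nf) m ↔ ClauseI reg (fun f => M₀ + m f) := by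
  have h : ∀ (f : Fin Nf) (k : ℕ), (reg.mcrit k + reg.a k * M₀ / reg.Zm k) + reg.a k * m f / reg.Zm k =
      reg.mcrit k + reg.a k * (M₀ + m f) / reg.Zm k := by
    intro f k; ring
  simp only [ClauseI, h]

/-- Clause (ii) likewise. [folklore] -/
theorem upper_shift (reg : QCDRegularisation Nf) (M₀ : ℝ) (m : Fin Nf → ℝ) :
    Upper ({ reg with mcrit := fun k => reg.mcrit k + reg.a k * M₀ / reg.Zm k } :
        QCDRegularisation Nf) m ↔ Upper reg (fun f => M₀ + m f) := by
  simp only [Upper, bare_shift]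

/-- Clause (iii) likewise. [folklore] -/
theorem lower_shift (reg : QCDRegularisation Nf) (M₀ : ℝ) (m : Fin Nf → ℝ) :
    Lower ({ reg with mcrit := fun k => reg.mcrit k + reg.a k * M₀ / reg.Zm k } :
        QCDRegularisation Nf) m ↔ Lower reg (fun f => M₀ + m f) := by
  simp only [Lower, bare_shift]

/-- Clause (iv) likewise. [folklore] -/
theorem sign_shift (reg : QCDRegularisation Nf) (M₀ : ℝ) (m : Fin Nf → ℝ) :
    Sign ({ reg with mcrit := fun k => reg.mcrit k + reg.a k * M₀ / reg.Zm k } :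
        QCDRegularisation Nf) m ↔ Sign reg (fun f => M₀ + m f) := by
  have h := bare_shift reg M₀ m
  unfold Sign
  simp only [h]

/-- **The UNPINNED package is invariant under every upward shift** `M₀ ≥ 0`: positive tuples of the
shifted regularisation are positive tuples `> M₀` of the original. [folklore] -/
theorem clauses_shift {reg : QCDRegularisation Nf} (h : Clauses Nf reg) {M₀ : ℝ} (hM : 0 ≤ M₀) :
    Clauses Nf ({ reg with mcrit := fun k => reg.mcrit k + reg.a k * M₀ / reg.Zm k } :
        QCDRegularisation Nf) := by
  refine ⟨(Summit.QuantumFields.QCD.Theorems.RobustYangMillsHandover.Negative.hasMassScaling_mcrit_shift_iff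
      reg M₀).2 h.1, (hasAsymptoticScaling_shift reg M₀).2 h.2.1, fun m hm => ?_⟩
  have hm' : ∀ f, 0 < M₀ + m f := fun f => by linarith [hm f]
  obtain ⟨h1, h2, h3, h4⟩ := h.2.2 _ hm'
  exact ⟨(clauseI_shift reg M₀ m).2 h1, (upper_shift reg M₀ m).2 h2,
    (lower_shift reg M₀ m).2 h3, (sign_shift reg M₀ m).2 h4⟩

/-- **Refuted free-standing split (modulo a gapped witness).**  If ONE regularisation carries the
unpinned package together with a uniform lattice gap `ε` at all positive tuples (what any proof of the
old `QCDOf`/`MobilityGap` milestone "above the offset" produces), then there is a regularisation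
carrying the unpinned package which is NOT chiral at zero (its shift by `M₀ = 1`) — so
`∀ reg, Clauses reg → reg.IsChiralAtZero` (the pin as an independent item over arbitrary witnesses) is
FALSE, and the pin can only be an obligation on the prover's own `∃`-witness (route text
"EdgeGaplessness … cannot be split off"). [folklore] -/
theorem exists_clauses_not_chiral_of_gappedWitness
    (hex : ∃ reg : QCDRegularisation Nf, Clauses Nf reg ∧
      ∃ ε > (0 : ℝ), ∀ m : Fin Nf → ℝ, (∀ f, 0 < m f) → (reg.scheme m 0 0).HasLatticeMassGap ε) :
    ∃ reg : QCDRegularisation Nf, Clauses Nf reg ∧ ¬ reg.IsChiralAtZero := by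
  obtain ⟨reg, hC, ε, hε, hgap⟩ := hex
  exact ⟨{ reg with mcrit := fun k => reg.mcrit k + reg.a k * 1 / reg.Zm k },
    clauses_shift hC zero_le_one,
    Summit.QuantumFields.QCD.Theorems.RobustYangMillsHandover.Negative.not_isChiralAtZero_mcrit_shift_of_uniformGapAbove
      reg 1 hε fun m hm => hgap m fun f => by linarith [hm f]⟩

/-- The same, as the negation of the free-standing implication. [folklore] -/
theorem not_forall_clauses_imp_chiral_of_gappedWitness
    (hex : ∃ reg : QCDRegularisation Nf, Clauses Nf reg ∧
      ∃ ε > (0 : ℝ), ∀ m : Fin Nf → ℝ, (∀ f, 0 < m f) → (reg.scheme m 0 0).HasLatticeMassGap ε) :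
    ¬ ∀ reg : QCDRegularisation Nf, Clauses Nf reg → reg.IsChiralAtZero := by
  intro hall
  obtain ⟨reg, hC, hnc⟩ := exists_clauses_not_chiral_of_gappedWitness hex
  exact hnc (hall reg hC)

/-- **Softness of the pin (equal-time blow-up).**  If at ONE positive mass tuple some pair of
observables has UNBOUNDED equal-time connected correlation along the regularisation — frequently in `k`,
at some admissible volume `S ≥ L_k` — then `reg` is chiral at zero for EVERY `ε`: the separation `n = 0`
of `HasLatticeMassGap` kills the rate.  Such a blow-up is a sign-problem artefact of the signed
normalisation `∫ det dμ_W` at volumes `S > L_k`, which clause (iv) (stated at side `2L_k+1` only) does not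
police; physically it does not happen, but the pin as typed does not exclude being met this way. -/
theorem isChiralAtZero_of_equalTime_unbounded (reg : QCDRegularisation Nf)
    (h : ∃ m : Fin Nf → ℝ, (∀ f, 0 < m f) ∧ ∃ (R R' : ℕ) (A : QCDLatticeObservable Nf R)
      (B : QCDLatticeObservable Nf R'), ∀ C : ℝ, ∃ᶠ k in atTop, ∃ S : ℕ, reg.L k ≤ S ∧
        C < ‖qcdLatticeConnectedCorr (reg.β k) (2 * S + 1)
          (fun fl => reg.mcrit k + reg.a k * m fl / reg.Zm k) A B 0‖) :
    reg.IsChiralAtZero := by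
  intro ε _
  obtain ⟨m, hm, R, R', A, B, hAB⟩ := h
  refine ⟨m, hm, fun hgap => ?_⟩
  obtain ⟨C, hC⟩ := hgap R R' A B
  obtain ⟨k, ⟨S, hS, hlt⟩, hk⟩ := ((hAB C).and_eventually hC).exists
  have h0 := hk S hS 0 (Nat.zero_le S)
  simp only [QCDRegularisation.scheme, Nat.cast_zero, mul_zero, neg_zero, Real.exp_zero,
    mul_one] at h0
  exact absurd (lt_of_lt_of_le hlt h0) (lt_irrefl C)

/-- **The pin is a `liminf` condition**: it is implied by gaplessness witnessed along ANY set of `k`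
that is merely cofinal — e.g. if for every `ε` some positive tuple has an observable pair whose
correlation beats `C e^{-ε a_k n}` for infinitely many `k` (at some `S ≥ L_k`, `n ≤ S`).  (This is
just the negation of `∃ C, ∀ᶠ k, …` unfolded; recorded because it means the pin constrains the
offset of `m_crit(k)` only along a subsequence, cf. `QCDGoldstoneBound`'s remark that
`IsChiralAtZero` is not inherited by subsequences.) -/
theorem isChiralAtZero_of_frequently (reg : QCDRegularisation Nf)
    (h : ∀ ε > (0 : ℝ), ∃ m : Fin Nf → ℝ, (∀ f, 0 < m f) ∧ ∃ (R R' : ℕ)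
      (A : QCDLatticeObservable Nf R) (B : QCDLatticeObservable Nf R'), ∀ C : ℝ,
        ∃ᶠ k in atTop, ∃ S : ℕ, reg.L k ≤ S ∧ ∃ n : ℕ, n ≤ S ∧
          C * Real.exp (-(ε * (reg.a k * n))) <
            ‖qcdLatticeConnectedCorr (reg.β k) (2 * S + 1)
              (fun fl => reg.mcrit k + reg.a k * m fl / reg.Zm k) A B n‖) :
    reg.IsChiralAtZero := by
  intro ε hε
  obtain ⟨m, hm, R, R', A, B, hAB⟩ := h ε hε
  refine ⟨m, hm, fun hgap => ?_⟩
  obtain ⟨C, hC⟩ := hgap R R' A B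
  obtain ⟨k, ⟨S, hS, n, hn, hlt⟩, hk⟩ := ((hAB C).and_eventually hC).exists
  exact absurd (hk S hS n hn) (not_le.2 hlt)

/-- Conversely the pin unfolds to exactly that frequently-in-`k` form. -/
theorem isChiralAtZero_iff_frequently (reg : QCDRegularisation Nf) :
    reg.IsChiralAtZero ↔
      ∀ ε > (0 : ℝ), ∃ m : Fin Nf → ℝ, (∀ f, 0 < m f) ∧ ∃ (R R' : ℕ)
        (A : QCDLatticeObservable Nf R) (B : QCDLatticeObservable Nf R'), ∀ C : ℝ,
          ∃ᶠ k in atTop, ∃ S : ℕ, reg.L k ≤ S ∧ ∃ n : ℕ, n ≤ S ∧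
            C * Real.exp (-(ε * (reg.a k * n))) <
              ‖qcdLatticeConnectedCorr (reg.β k) (2 * S + 1)
                (fun fl => reg.mcrit k + reg.a k * m fl / reg.Zm k) A B n‖ := by
  refine ⟨fun h ε hε => ?_, isChiralAtZero_of_frequently reg⟩
  obtain ⟨m, hm, hng⟩ := h ε hε
  refine ⟨m, hm, ?_⟩
  by_contra hcon
  apply hng
  intro R R' A B
  by_contra hC
  apply hcon
  refine ⟨R, R', A, B, fun C => ?_⟩
  rw [not_exists] at hC
  have hC' := hC C
  rw [not_eventually] at hC'
  refine hC'.mono fun k hk => ?_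
  simp only [not_forall, not_le, exists_prop] at hk
  obtain ⟨S, hS, n, hn, hlt⟩ := hk
  exact ⟨S, hS, n, hn, hlt⟩

/-! ### §2 Clause (iv) on the diagonal of the `N_f = 2` mass plane is automatic -/

/-- For two DEGENERATE flavours the Wilson weight is the non-negative real `det D_W(t)²`, at every
gauge field and every bare mass `t` (supercritical included): `det = ‖det‖`. -/
theorem det_diracMatrix_two_degenerate_eq_norm {S : ℕ} [NeZero S] (U : GaugeConfig 4 S (Matrix.specialUnitaryGroup (Fin 3) ℂ))
    (t : ℝ) :
    (diracMatrix U (fun _ : Fin 2 => t)).det =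
      ((‖(diracMatrix U (fun _ : Fin 2 => t)).det‖ : ℝ) : ℂ) := by
  set d : ℂ := fermionDet (wilsonDirac (fundamentalRep (Fin 3)) U t 1) with hd
  have him : d.im = 0 := by
    simpa [hd] using fermionDet_wilsonDirac_im_holds (L := S) (fundamentalRep (Fin 3))
      (fun g => fundamentalRep_mem_unitaryGroup g) U t 1
  have hdre : d = ((d.re : ℝ) : ℂ) := Complex.ext (by simp) (by simp [him])
  have hdet : (diracMatrix U (fun _ : Fin 2 => t)).det = ((d.re ^ 2 : ℝ) : ℂ) := by
    rw [det_diracMatrix, Fin.prod_univ_two]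
    show d * d = ((d.re ^ 2 : ℝ) : ℂ)
    conv_lhs => rw [hdre]
    push_cast
    ring
  rw [hdet, Complex.norm_real, Real.norm_eq_abs, abs_of_nonneg (sq_nonneg _)]

/-- Hence the sign-coherence ratio is exactly `1` on the diagonal, at every coupling and side. -/
theorem signRatio_eq_one_two_degenerate {S : ℕ} [NeZero S] (β t : ℝ) :
    ‖∫ U : GaugeConfig 4 S (Matrix.specialUnitaryGroup (Fin 3) ℂ), (diracMatrix U (fun _ : Fin 2 => t)).det
        ∂(wilsonMeasure (fundamentalRep (Fin 3)) β)‖ /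
      (∫ U : GaugeConfig 4 S (Matrix.specialUnitaryGroup (Fin 3) ℂ), ‖(diracMatrix U (fun _ : Fin 2 => t)).det‖
        ∂(wilsonMeasure (fundamentalRep (Fin 3)) β)) = 1 := by
  have hZ := integral_norm_det_diracMatrix_pos_all (S := S) β (fun _ : Fin 2 => t)
  have hI : ∫ U : GaugeConfig 4 S (Matrix.specialUnitaryGroup (Fin 3) ℂ), (diracMatrix U (fun _ : Fin 2 => t)).det
        ∂(wilsonMeasure (fundamentalRep (Fin 3)) β) =
      ∫ U : GaugeConfig 4 S (Matrix.specialUnitaryGroup (Fin 3) ℂ), ((‖(diracMatrix U (fun _ : Fin 2 => t)).det‖ : ℝ) : ℂ)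
        ∂(wilsonMeasure (fundamentalRep (Fin 3)) β) :=
    integral_congr_ae (Eventually.of_forall fun U => det_diracMatrix_two_degenerate_eq_norm U t)
  rw [hI, integral_complex_ofReal, Complex.norm_real, Real.norm_eq_abs, abs_of_pos hZ, div_self hZ.ne']

/-- **Clause (iv) is void on the diagonal for `N_f = 2`**: along ANY regularisation, the degenerate
tuple `(t, t)` realises the degenerate bare tuple `(m_crit(k) + a_k t/Z_m(k)) · (1,1)`, whose sign
ratio is `1 ≥ 1/2` at every `k` — for every real `t`, positive or not.  So for `N_f = 2` the content of
(iv) lies entirely in SPLIT tuples `t₁ ≠ t₂` (real modes of `D_W(U,0,1)` in the window between the two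
bare masses; barrier `WilsonDeterminantMassSplitting`), while for `N_f = 3` (`det³`) no parity
cancellation exists at any tuple.  The pin, which quantifies `∃ m`, may therefore be discharged for
`N_f = 2` on the diagonal, where the signed functional is a positive-weight expectation. -/
theorem sign_two_degenerate (reg : QCDRegularisation 2) (t : ℝ) : Sign reg (fun _ => t) :=
  Eventually.of_forall fun k => by
    have h := signRatio_eq_one_two_degenerate (S := 2 * reg.L k + 1) (reg.β k)
      (reg.mcrit k + reg.a k * t / reg.Zm k)
    have e : (bare reg (fun _ : Fin 2 => t) k) = fun _ : Fin 2 => reg.mcrit k + reg.a k * t / reg.Zm k :=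
      rfl
    rw [e, h]
    norm_num

end Summit.QuantumFields.QCD.Theorems.ChiralMobilityGap.Negative

end
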